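import Summits.AtomisticToContinuum.HydrodynamicLimit.Theorems.InformationPercolationEnginePercolationClosesChaosForecastStatements
import HarnessLib

/-!
# Vocabulary of the line `equilibrium-forecast-chain-rule` for the crux `InformationPercolationEngine.PercolationClosesChaos`
(stmt-AtomisticToContinuum-15178) — part 3: the RE-TYPED statements of skeleton v5 (lead c3, line cycle 4)

Definitions-only support file (`--supports stmt-AtomisticToContinuum-15178`), companion of `…ForecastDefs.lean` (objects) and
`…ForecastStatements.lean` (the v2 statements). Skeleton v5 replaces three v2 statements after the cycle-4 wave (audits of workers
S5/S6 and the lead's own attack on S2):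

* `MesoConditionalEquidistribution` (v2) ⟶ `MesoForecastChaos` (= its conjunct (a), VERBATIM, as a stand-alone `Prop`) and
  `MesoStaticMaxwellRarity` (replacing its conjunct (b)). Why (b) goes: (α) its quantifier order `∀ δ' L → ∃ κ` lets the H-theorem
  gain `κ` degenerate with the tolerances it must beat (worker S5, `S5.audit.md`); (β, lead c3) independently of (α), (b) — and the
  static form (b″) first proposed by the worker — is FALSE at every large rate `L`: `Regular` has no OCCUPANCY FLOOR, so in a
  low-density macrostate (half the torus at `≈ 10⁻²` spheres per kinetic cell, the rest holding the other spheres; `G_N`-cost only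
  `e^{-(N+1)(log 2 + o(1))}`, persistent over the horizon) a positive, `c`-independent fraction of cells are ISOLATED PAIRS
  (`pop q = nbhd q`, hence `inhom = 0`, `Regular`) whose smoothed two-point velocity law is `ϑ`-non-Maxwellian with probability
  `O(1)` AT EQUILIBRIUM, at every time — no time-decorrelation can price a stationary feature; so `G_N{fraction > δ'} ≥ e^{-(N+1)}`
  for small `δ'`, contradicting `≤ e^{-L(N+1)}` for `L > 1`. The repaired statement counts only cells holding at least `m₀` spheres
  (`∃ m₀` chosen after `ϑs, ϑ, δ', L`): populated cells of ANY density macrostate are Maxwellian up to velocity fluctuations of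
  `G_N`-probability `p_{m₀} → 0`, and Knudsen (unrelaxed, counter-streaming) layers have macroscopic thickness
  `≲ ℓ_N n̄/(c m₀) → 0`; the residual large-deviation content is the space-time concentration of VELOCITY fluctuations, which DO
  decorrelate (transport renews a cell's sample every step). It is consumed by the static Cesàro assembly of S5 (Option C of the
  S5 audit: no predictable projection, no conditional H-theorem, no bin reconstruction).
* `NoMesoscopicOscillation` (v2) ⟶ `NoMesoscopicOscillationR` (= its conjunct (i), VERBATIM: the `[cℓ_N, r]` residual the docking
  consumes) and `NoKineticIrregularity` (replacing its conjunct (ii)). Why (ii) goes: (γ, worker S5) it is VACUOUS as typed — the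
  summand `𝟙{nbhd q ≠ ∅ ∧ ϑ < inhom}` is `1` on infinitely many NON-cells `q ∈ ℤ³ ∖ range cellOf` (cell centres wrap around the
  torus; `pop q = ∅` there, `inhom = ∫ kde (nbhd q) = 1`), so for `ϑ < 1` the `tsum` inside `unitAvg` is the junk `0`; the
  re-typed statement guards "`q` is an actual kinetic cell" and also absorbs the occupancy floor of `MesoStaticMaxwellRarity`
  (occupied cells with fewer than `m₀` spheres: kinetic RAREFACTION, an LG-side no-cavitation input of the `DensityCap` class).

Unchanged and still consumed from `…ForecastStatements.lean`: `KineticCellChaosLG`, `LocalCountUI`, `CoarseLocalMaxwellianity`,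
`RevealedDefectStability`, and the v2 texts themselves (kept: other files import them; `noMesoscopicOscillationR_of` and
`mesoForecastChaos_of` below record that the new statements are conjuncts of the old). Nothing is asserted here: every `def` is a
predicate the registered stubs of skeleton v5 prove or consume.
-/

noncomputable section

open MeasureTheory Set Filter Topology
open scoped ENNReal BigOperators Classical
open Literature.Analysis.FluidPDE Literature.MathematicalPhysics.KineticTheory
open Literature.MathematicalPhysics.KineticTheory.VelocityBlindPlacement

namespace Summit.AtomisticToContinuum.HydrodynamicLimit.Theorems.EquilibriumForecastLine

/-! ## §5' The re-typed statements of skeleton v5 -/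

/-- **`MesoForecastChaos`** — FORECAST CHAOS OF GOOD UNITS UNDER THE INVARIANT LAW, EXCEPT ON A LARGE-DEVIATION-RARE SPACE-TIME
DENSITY OF UNITS (conjunct (a) of `MesoConditionalEquidistribution` v2, verbatim, as a stand-alone statement; crux-class, OPEN —
the stub the lead hands back as `promote-stub`). There are an absolute packing threshold `φs > 0` and `σ₁ > 0` such that for every
`0 < σ ≤ σ₁`, every flow family, every horizon `τ > 0`, every bounded continuous mark test `Ψ` and `ϑs, η, δ, T, δ', L > 0` there are
`ϑ > 0` and `c₀` with: for all `c ≥ c₀`, all bin widths `b > 0` and all large `N`,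
`G_N{ z | unit-fraction of (k, q) GOOD at kΔ with E_{G_N}[badWeight Ψ η T (k,q) | σ(seqHist b c σ N Φ k q)](z) > δ exceeds δ' }
≤ e^{−L(N+1)}`.
Why every rate `L` is plausible here (lead c3, cycle 4 — contrast `MesoStaticMaxwellRarity`): a unit carries the functional only
through `≍ n̄ c` owned collisions (`badWeight ≤ min(ownedCount, T)`; sparse cells weigh nothing), its defect is SELF-REFERENTIAL
(collision marks against flux ⊗ the populations' OWN pair law: an anomalous velocity law is not a defect) and packed cells are not
`GoodUnit`; a bad `G_N`-forecast of a good weighty unit needs `≍ η n̄ c` record-certified geometric constraints on its upcoming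
collisions (cradle / cascade atoms of the v1 kill record), each of `G_N`-cost bounded below, so already the ONE-TIME spatial
large-deviation rate is `≳ η c δ' (N+1)`, super-linear in `c` — `∃ c₀(L)` is what the statement offers. Why it might still fail: a
family of forecast-bad revealed patterns of `G_N`-cost `o(n̄ c)` per weighty unit; long-range dynamical coherence regenerating
cascades for free. Mechanism wanted (unprinted for `N ≥ 3` hard balls): a quantitative growth lemma with exceptional set plus an
influence-locality bound for history-defined local events under the invariant law (doi:10.1090/surv/127 Ch. 5/7,
doi:10.1007/s00023-008-0389-1, ChernovDolgopyat2009; KipnisLandim1999 A1.8 for the transfer). -/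
def MesoForecastChaos : Prop :=
  ∃ φs : ℝ, 0 < φs ∧ ∃ σ₁ : ℝ, 0 < σ₁ ∧ ∀ σ : ℝ, 0 < σ → σ ≤ σ₁ → ∀ Φ : (N : ℕ) → Flow σ N, ∀ τ : ℝ, 0 < τ →
  ∀ Ψ : V3 × V3 × V3 → ℝ, Continuous Ψ → (∃ C : ℝ, ∀ p, |Ψ p| ≤ C) →
    ∀ ϑs η δ T δ' L : ℝ, 0 < ϑs → 0 < η → 0 < δ → 0 < T → 0 < δ' → 0 < L →
    ∃ ϑ : ℝ, 0 < ϑ ∧ ∃ c₀ : ℝ, 0 < c₀ ∧ ∀ c : ℝ, c₀ ≤ c → ∀ b : ℝ, 0 < b →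
    ∃ N₀ : ℕ, ∀ N : ℕ, N₀ ≤ N →
      eqLaw σ N (Φ N) {z | δ' < unitAvg c σ N τ fun k q =>
        if GoodUnit ϑs ϑ φs c σ N ((Φ N).flow ((k : ℝ) * stepLen c σ N) z) q ∧
            δ < MeasureTheory.condExp (MeasurableSpace.comap (seqHist b c σ N (Φ N) k q) ⊤) (eqLaw σ N (Φ N))
              (badWeight Ψ η T c σ N (Φ N) k q) z
        then 1 else 0} ≤ ENNReal.ofReal (Real.exp (-(L * ((N : ℝ) + 1))))

/-- `MesoForecastChaos` is conjunct (a) of the v2 statement `MesoConditionalEquidistribution` (nothing new is claimed by the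
re-typing on this side). -/
theorem mesoForecastChaos_of : MesoConditionalEquidistribution → MesoForecastChaos := by
  intro h
  obtain ⟨φs, hφs, σ₁, hσ₁, H⟩ := h
  exact ⟨φs, hφs, σ₁, hσ₁, fun σ hσ hσ₁' Φ τ hτ => (H σ hσ hσ₁' Φ τ hτ).1⟩

/-- **`MesoStaticMaxwellRarity`** — POPULATED REGULAR KINETIC CELLS ARE LARGE-DEVIATION-RARELY NON-MAXWELLIAN IN SPACE-TIME UNDER
THE INVARIANT LAW (v5; replaces conjunct (b) of `MesoConditionalEquidistribution` v2 — see the module docstring for the two kills: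
(α) quantifier order of the H-theorem gain, (β) isolated pairs of a low-density macrostate, a STATIONARY equilibrium feature of
`G_N`-cost `e^{-O(N)}` defeating every rate `L > 1` for any statement without an occupancy floor). There are `φs > 0` and `σ₁ > 0`
such that for `0 < σ ≤ σ₁`, every flow family, `τ > 0` and `ϑs, ϑ, δ', L > 0` there are an OCCUPANCY FLOOR `m₀ : ℕ`, a homogeneity
threshold `ϑh > 0` and `c₀` with: for `c ≥ c₀` and all large `N`,
`G_N{ z | unit-fraction of (k, q) with q REGULAR at kΔ (not φs-packed, ϑh-homogeneous in its 4cℓ-neighbourhood), holding AT LEAST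
m₀ spheres, and ϑ-NON-MAXWELLIAN (smoothed relative entropy relEntAt (kΔ) q ≥ ϑ) exceeds δ' } ≤ e^{−L(N+1)}`.
Content: under `G_N` the configuration at time `kΔ` is again `G_N`-distributed (invariance) with velocities i.i.d. Maxwellian
given the positions; a cell holding `m ≥ m₀` spheres is `ϑ`-non-Maxwellian with probability `p_m ≤ p_{m₀} → 0` (smoothed empirical
law of `m` Gaussians against the Maxwellian with its own mean and temperature), whatever the density macrostate; Knudsen layers
(populated but unrelaxed, counter-streaming cells between macrostates) have thickness `≲ ℓ_N n̄/(c m₀) → 0`; what is asked beyond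
the one-time mean `≪ δ'` is the SPACE-TIME concentration at every rate `L(N+1)` — velocity fluctuations of a cell's sample are
renewed by transport every step and by collisions `c` times a step (the large-deviation content; super-extensive speed
`≍ δ'² K_N (N+1)` heuristically). Consumed by S5 (`CoarseLocalMaxwellianity` via the entropy inequality, `LocalCountUI` (ii) for
packed cells and `NoKineticIrregularity` for inhomogeneous / void-adjacent / under-populated occupied cells). Why it might fail:
a `G_N`-cheap (rate `O(δ')`) PERSISTENT mechanism keeping populated homogeneous dilute cells non-Maxwellian — none known (the
summand vanishes on empty cells since `relEnt ∅ = 0 < ϑ`, so no junk support off the kinetic box). Crux-class with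
`MesoForecastChaos` (same missing dynamical large-deviation / decorrelation input for `N ≥ 3` hard balls), but strictly easier:
no conditioning, no records, velocities Gaussian under `G_N`. -/
def MesoStaticMaxwellRarity : Prop :=
  ∃ φs : ℝ, 0 < φs ∧ ∃ σ₁ : ℝ, 0 < σ₁ ∧ ∀ σ : ℝ, 0 < σ → σ ≤ σ₁ → ∀ Φ : (N : ℕ) → Flow σ N, ∀ τ : ℝ, 0 < τ →
  ∀ ϑs ϑ δ' L : ℝ, 0 < ϑs → 0 < ϑ → 0 < δ' → 0 < L →
    ∃ m₀ : ℕ, ∃ ϑh : ℝ, 0 < ϑh ∧ ∃ c₀ : ℝ, 0 < c₀ ∧ ∀ c : ℝ, c₀ ≤ c → ∃ N₀ : ℕ, ∀ N : ℕ, N₀ ≤ N →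
      eqLaw σ N (Φ N) {z | δ' < unitAvg c σ N τ fun k q =>
        if Regular ϑs ϑh φs c σ N ((Φ N).flow ((k : ℝ) * stepLen c σ N) z) q ∧
            m₀ ≤ (pop c σ N ((Φ N).flow ((k : ℝ) * stepLen c σ N) z) q).card ∧
            ϑ ≤ relEntAt ϑs c σ N (Φ N) ((k : ℝ) * stepLen c σ N) q z then 1 else 0}
        ≤ ENNReal.ofReal (Real.exp (-(L * ((N : ℝ) + 1))))

/-- **`NoMesoscopicOscillationR`** — NO STRUCTURE OF THE EVOLVED ONE-BODY LAW BETWEEN THE KINETIC CELL AND THE `r`-BALL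
(conjunct (i) of `NoMesoscopicOscillation` v2, verbatim, as a stand-alone statement: the shared `[cℓ_N, r]` residual of every line
on this crux, typed against the target's own reference `targetPm`; consumed by the docking S7 only; item-class / the route's kill
criterion (iv)). For continuous positive profiles there is `σ₀ > 0` such that for `0 < σ < σ₀`, every flow family and `τ > 0`, every
bounded continuous `Ξ` and `η, δ > 0` there is `r₀ > 0` such that for `0 < r < r₀` there is `c₀` with: for `c ≥ c₀` and all large `N`,
with `LG`-probability `≥ 1 − δ` the unit average over `(k, q)` of
`Σ_{q'} collPair 1 (q,q') · |A_r(kΔ, centre q) · (pairPair Ξ / pairPair 1)(q,q') − B^Ξ_r(kΔ, centre q)|` is `≤ η`. Why it might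
fail: two-stream patterns at scales `cℓ_N ≪ s ≪ r`, rough (turbulent) limit fields (Disproof F10 b) — then the target itself is in
doubt. -/
def NoMesoscopicOscillationR : Prop :=
  ∀ (a₀ θ₀ : T3 → ℝ) (u₀ : T3 → V3), Continuous a₀ → Continuous θ₀ → Continuous u₀ →
    (∀ x, 0 < a₀ x) → (∀ x, 0 < θ₀ x) →
  ∃ σ₀ : ℝ, 0 < σ₀ ∧ ∀ σ : ℝ, 0 < σ → σ < σ₀ → ∀ Φ : (N : ℕ) → Flow σ N, ∀ τ : ℝ, 0 < τ →
  ∀ Ξ : V3 × V3 × V3 → ℝ, Continuous Ξ → (∃ C : ℝ, ∀ p, |Ξ p| ≤ C) →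
    ∀ η δ : ℝ, 0 < η → 0 < δ → ∃ r₀ : ℝ, 0 < r₀ ∧ ∀ r : ℝ, 0 < r → r < r₀ →
    ∃ c₀ : ℝ, 0 < c₀ ∧ ∀ c : ℝ, c₀ ≤ c → ∃ N₀ : ℕ, ∀ N : ℕ, N₀ ≤ N →
      localGibbsLaw σ a₀ u₀ θ₀ N (Φ N) {z | η < unitAvg c σ N τ fun k q => ∑' q' : Cell,
        collPair (fun _ => 1) c σ N (Φ N) k q q' z *
          |targetPm (fun _ => 1) r τ σ N (Φ N) z ((k : ℝ) * stepLen c σ N) (cellCentre c σ N q) *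
              (pairPair Ξ c σ N (Φ N) k q q' z / pairPair (fun _ => 1) c σ N (Φ N) k q q' z) -
            targetPm Ξ r τ σ N (Φ N) z ((k : ℝ) * stepLen c σ N) (cellCentre c σ N q)|} ≤ ENNReal.ofReal δ

/-- `NoMesoscopicOscillationR` is conjunct (i) of the v2 statement `NoMesoscopicOscillation`. -/
theorem noMesoscopicOscillationR_of : NoMesoscopicOscillation → NoMesoscopicOscillationR := by
  intro h a₀ θ₀ u₀ ha hθ hu ha0 hθ0
  obtain ⟨σ₀, hσ₀, H⟩ := h a₀ θ₀ u₀ ha hθ hu ha0 hθ0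
  exact ⟨σ₀, hσ₀, fun σ hσ hσ' Φ τ hτ => (H σ hσ hσ' Φ τ hτ).1⟩

/-- **`NoKineticIrregularity`** — OCCUPIED-OR-VOID-ADJACENT KINETIC CELLS ARE RARELY IRREGULAR UNDER THE EVOLVED LAW (v5; replaces
conjunct (ii) of `NoMesoscopicOscillation` v2, which was vacuous as typed — module docstring (γ) — and absorbs the occupancy floor of
`MesoStaticMaxwellRarity`; item-class LG-side regularity input, `LocalCountUI`-adjacent, to be FILED by the planner). For continuous
positive profiles there is `σ₀ > 0` such that for `0 < σ < σ₀`, every flow family, `τ > 0`, every `ϑs, ϑ, δ > 0` and every floor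
`m₀ : ℕ` there is `c₀` with: for `c ≥ c₀` and all large `N`, the `LG`-expectation of the unit-fraction of ACTUAL kinetic cells `q`
(`q ∈ range cellOf`) with a populated `4cℓ`-neighbourhood at `kΔ` that are either `ϑ`-INHOMOGENEOUS (`L¹` distance of the smoothed
velocity laws of the cell and of its neighbourhood `> ϑ`; an EMPTY such cell has `inhom = 1`: kinetic voids count) or OCCUPIED BY
FEWER THAN `m₀` SPHERES (kinetic rarefaction) is at most `δ`. Why plausibly true: under local Gibbs data with continuous positive
profiles a cell holds `≍ a₀(x) n̄(c) → ∞` spheres, its smoothed empirical law and its neighbourhood's are within sampling noise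
`O(n̄^{-1/2})` plus gradient `O(cℓ_N |∇|)` of the same local Maxwellian, and voids / under-populated cells have probability
`e^{-Θ(n̄)}` — at time `0` provable; at positive times it is propagation of "no cavitation, no cell-scale velocity structure" for the
evolved law (the `DensityCap` 13082 class, lower instead of upper). Why it might fail: vacuum formation / implosion pockets at
positive times; a cell-scale two-stream structure of the evolved law (then `NoMesoscopicOscillationR` fails too). -/
def NoKineticIrregularity : Prop :=
  ∀ (a₀ θ₀ : T3 → ℝ) (u₀ : T3 → V3), Continuous a₀ → Continuous θ₀ → Continuous u₀ →
    (∀ x, 0 < a₀ x) → (∀ x, 0 < θ₀ x) →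
  ∃ σ₀ : ℝ, 0 < σ₀ ∧ ∀ σ : ℝ, 0 < σ → σ < σ₀ → ∀ Φ : (N : ℕ) → Flow σ N, ∀ τ : ℝ, 0 < τ →
  ∀ ϑs ϑ δ : ℝ, ∀ m₀ : ℕ, 0 < ϑs → 0 < ϑ → 0 < δ → ∃ c₀ : ℝ, 0 < c₀ ∧ ∀ c : ℝ, c₀ ≤ c → ∃ N₀ : ℕ, ∀ N : ℕ, N₀ ≤ N →
    ∫⁻ z, ENNReal.ofReal (unitAvg c σ N τ fun k q =>
        if (∃ x : T3, cellOf c σ N x = q) ∧ (nbhd c σ N ((Φ N).flow ((k : ℝ) * stepLen c σ N) z) q).Nonempty ∧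
            (ϑ < inhom ϑs ((Φ N).flow ((k : ℝ) * stepLen c σ N) z)
                (pop c σ N ((Φ N).flow ((k : ℝ) * stepLen c σ N) z) q)
                (nbhd c σ N ((Φ N).flow ((k : ℝ) * stepLen c σ N) z) q) ∨
              ((pop c σ N ((Φ N).flow ((k : ℝ) * stepLen c σ N) z) q).Nonempty ∧
                (pop c σ N ((Φ N).flow ((k : ℝ) * stepLen c σ N) z) q).card < m₀)) then 1 else 0)
      ∂(localGibbsLaw σ a₀ u₀ θ₀ N (Φ N)) ≤ ENNReal.ofReal δ

/-- A member of the population of `q` certifies that `q` is an actual kinetic cell with a populated neighbourhood (the guard of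
`NoKineticIrregularity` holds on every occupied cell). [folklore] -/
theorem actual_and_nbhd_of_pop_nonempty {σ : ℝ} {N : ℕ} {c : ℝ} (hh : 0 ≤ c * meanFreePath σ N) (w : Phase N) (q : Cell)
    (hne : (pop c σ N w q).Nonempty) : (∃ x : T3, cellOf c σ N x = q) ∧ (nbhd c σ N w q).Nonempty := by
  obtain ⟨i, hi⟩ := hne
  simp only [pop, Finset.mem_filter, Finset.mem_univ, true_and] at hi
  refine ⟨⟨(w i).1, hi⟩, ⟨i, ?_⟩⟩
  simp only [nbhd, Finset.mem_filter, Finset.mem_univ, true_and, hi, Torus.euclidDist_self]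
  positivity

end Summit.AtomisticToContinuum.HydrodynamicLimit.Theorems.EquilibriumForecastLine

end
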